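import Summits.CriticalPhenomena.CardyFormulaZ2.Theorems.CardyComplexConeParafermionToSLESixFamiliesDiamondClassModes
import HarnessLib

/-!
# Line `potential-darboux-picard-diamond`, conjunct (b′) of S3: mode selection for potentials from `EdgeCoherence`

Helper file of the conditional stub of S3 (b′) `ClosedClass` (`closedClass_of_edgeCoherence_edgePrecompact`) of crux
`ParafermionToSLESixFamilies` (stmt-CriticalPhenomena-11389), line `potential-darboux-picard-diamond`; continues
`…DiamondClassModes` (the pointwise algebra of the two corner defects `holDefect`, `antiDefect`).

**Main statement** (`pairedSmall_of_edgeCoherence`, registered helper): under the route item `EdgeCoherence`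
(stmt-11385), EITHER for every guarded family (`Guards`: `(Λ δ).Ω = D`, mesh `δ`, eventually admissible) the holomorphic
corner defects of the corner observable are `o(δ^{1/3})` in horizontal pairs `v, v + e₀` uniformly on compacts, OR for
every guarded family the antiholomorphic ones are — the SAME alternative for all families, read off the universal class
vector `u`: with `w = u ∘ classShift` also a coherence vector (landed `stub_coherenceShift`), a non-zero minor kills all
corner values (`corner_bound_of_minor`); otherwise `u = u(0)(1, χ, χ², χ³)` with `χ⁴ = 1` (`character_of_minors`),
`χ ∈ {1, −i}` kill `holDefect` and `χ = −1` kills `antiDefect` pointwise, and the staggered character `χ = i` kills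
`holDefect` in pairs through Kirchhoff's vertex relation (landed `stub_kirchhoff`). `EdgePrecompact` is not used.
-/

noncomputable section

namespace Summit.CriticalPhenomena.CardyFormulaZ2.Cruxes.ParafermionToSLESixFamilies.PotentialDarbouxPicardDiamond

open scoped Topology
open Filter Set Metric Complex
open Literature.Probability Literature.Probability.LatticeModels Literature.Probability.Percolation
open Literature.Probability.RandomPlanarGeometry
open Summit.CriticalPhenomena.CardyFormulaZ2.Theses.CardyComplexCone (EdgeCoherence)
open Summit.CriticalPhenomena.CardyFormulaZ2.Cruxes.CoherentMorera
open Summit.CriticalPhenomena.CardyFormulaZ2.Cruxes.CoherentMorera.FinitaryGreenPairing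
  (e0 e1 classShift EdgeCoherenceWith Guards KirchhoffRel cornersAt stub_coherenceShift
    stub_kirchhoff medialPoint_horizontal meshPoint_add_e0)
open Summit.CriticalPhenomena.CardyFormulaZ2.Cruxes.CoherentMorera.FinitaryGreenPairing.ModeSelection

/-! ## From `EdgeCoherence` to the smallness of one defect, for every guarded family -/

/-- A compact neighbourhood `K'` of the compact `K ⊆ D` inside `D` containing, for all small `δ`, the mesh points of
`v` and `v + e₀` and the medial point of the edge `s(v, v + e₀)` whenever `δ v ∈ K`. -/
theorem eventually_pair_near {D : DobrushinDomain} {K : Set ℂ} (hK : IsCompact K) (hKD : K ⊆ D.carrier) :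
    ∃ K' : Set ℂ, IsCompact K' ∧ K' ⊆ D.carrier ∧ ∀ᶠ δ in 𝓝[>] (0:ℝ), ∀ v : Site 2, meshPoint δ v ∈ K →
      meshPoint δ v ∈ K' ∧ meshPoint δ (v + e0) ∈ K' ∧ medialPoint δ s(v, v + Pi.single 0 1) ∈ K' := by
  obtain ⟨ρ, hρ, hρD⟩ := hK.exists_cthickening_subset_open D.isOpen hKD
  refine ⟨cthickening ρ K, hK.cthickening, hρD, ?_⟩
  filter_upwards [Ioc_mem_nhdsGT hρ] with δ hδ v hv
  refine ⟨self_subset_cthickening K hv, mem_cthickening_of_dist_le _ _ ρ K hv ?_,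
    mem_cthickening_of_dist_le _ _ ρ K hv ?_⟩
  · rw [meshPoint_add_e0, dist_eq_norm, add_sub_cancel_left, Complex.norm_real, Real.norm_of_nonneg hδ.1.le]
    exact hδ.2
  · rw [medialPoint_horizontal, dist_eq_norm, add_sub_cancel_left, Complex.norm_real,
      Real.norm_of_nonneg (by linarith [hδ.1])]
    linarith [hδ.1, hδ.2]

/-- **Mode selection for potentials** (registered helper of S3 (b′)). Under the route item `EdgeCoherence`, EITHER for
every guarded family the holomorphic corner defects are `o(δ^{1/3})` in horizontal pairs uniformly on compacts, OR for
every guarded family the antiholomorphic ones are. (Which alternative holds is read off the universal class vector `u`: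
a non-zero minor or a character `χ ∈ {1, i, −i}` gives the first, `χ = −1` the second.) -/
theorem pairedSmall_of_edgeCoherence : EdgeCoherence → (∀ (D : DobrushinDomain) (Λ : ℝ → DiscreteDobrushin), Guards D Λ → ∀ K : Set ℂ, IsCompact K → K ⊆ D.carrier → ∀ ε > (0:ℝ), ∀ᶠ δ in 𝓝[>] (0:ℝ), ∀ v : Site 2, meshPoint δ v ∈ K → ‖holDefect (FinitaryGreenPairing.cornerObs Λ δ) v + holDefect (FinitaryGreenPairing.cornerObs Λ δ) (v + e0)‖ ≤ ε * δ ^ ((1:ℝ) / 3)) ∨ (∀ (D : DobrushinDomain) (Λ : ℝ → DiscreteDobrushin), Guards D Λ → ∀ K : Set ℂ, IsCompact K → K ⊆ D.carrier → ∀ ε > (0:ℝ), ∀ᶠ δ in 𝓝[>] (0:ℝ), ∀ v : Site 2, meshPoint δ v ∈ K → ‖antiDefect (FinitaryGreenPairing.cornerObs Λ δ) v + antiDefect (FinitaryGreenPairing.cornerObs Λ δ) (v + e0)‖ ≤ ε * δ ^ ((1:ℝ) / 3)) := by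
  rintro ⟨u, ⟨os, hos, hus⟩, hu⟩
  have hw : EdgeCoherenceWith (fun o => u (classShift o)) := stub_coherenceShift u hu
  -- the two coherence statements over the family-form corner observable (definitional unfolding)
  have cohU : ∀ (D : DobrushinDomain) (Λ : ℝ → DiscreteDobrushin), Guards D Λ → ∀ K : Set ℂ, IsCompact K →
      K ⊆ D.carrier → ∀ t > (0:ℝ), ∀ᶠ δ in 𝓝[>] (0:ℝ), ∀ v f f' : Site 2, IsCorner v f → IsCorner v f' →
        meshPoint δ v ∈ K → ‖u (f' - v) * FinitaryGreenPairing.cornerObs Λ δ (v, f) -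
          u (f - v) * FinitaryGreenPairing.cornerObs Λ δ (v, f')‖ ≤ t * δ ^ ((1:ℝ) / 3) :=
    fun D Λ hG K hK hKD t ht => hu D Λ hG.1 hG.2.1 hG.2.2 K hK hKD t ht
  have cohW : ∀ (D : DobrushinDomain) (Λ : ℝ → DiscreteDobrushin), Guards D Λ → ∀ K : Set ℂ, IsCompact K →
      K ⊆ D.carrier → ∀ t > (0:ℝ), ∀ᶠ δ in 𝓝[>] (0:ℝ), ∀ v f f' : Site 2, IsCorner v f → IsCorner v f' →
        meshPoint δ v ∈ K → ‖u (classShift (f' - v)) * FinitaryGreenPairing.cornerObs Λ δ (v, f) -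
          u (classShift (f - v)) * FinitaryGreenPairing.cornerObs Λ δ (v, f')‖ ≤ t * δ ^ ((1:ℝ) / 3) :=
    fun D Λ hG K hK hKD t ht => hw D Λ hG.1 hG.2.1 hG.2.2 K hK hKD t ht
  set S : ℝ := ‖u 0‖ + ‖u (-e0)‖ + ‖u (-e0 - e1)‖ + ‖u (-e1)‖ with hS
  have hSpos : 0 < S := lt_of_lt_of_le (norm_pos_iff.2 hus) (norm_le_sum_of_isCorner u hos)
  by_cases hmin : ∃ o, IsCorner 0 o ∧ u os * u (classShift o) - u o * u (classShift os) ≠ 0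
  · -- a non-zero minor: every corner value is small, hence so are the holomorphic defects
    obtain ⟨o, ho, hd⟩ := hmin
    have hdpos : 0 < ‖u os * u (classShift o) - u o * u (classShift os)‖ := norm_pos_iff.2 hd
    left
    intro D Λ hG K hK hKD ε hε
    obtain ⟨K', hK', hK'D, hnear⟩ := eventually_pair_near hK hKD
    have ht : 0 < ε * ‖u os * u (classShift o) - u o * u (classShift os)‖ / (24 * S) := by positivity
    filter_upwards [cohU D Λ hG K' hK' hK'D _ ht, cohW D Λ hG K' hK' hK'D _ ht, hnear] with δ hU hW hn v hv
    obtain ⟨hv0, hv1, -⟩ := hn v hv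
    set E := FinitaryGreenPairing.cornerObs Λ δ with hE
    set dm : ℝ := ‖u os * u (classShift o) - u o * u (classShift os)‖ with hdm
    set t : ℝ := ε * dm / (24 * S) * δ ^ ((1:ℝ) / 3) with htd
    have key : ∀ w : Site 2, meshPoint δ w ∈ K' → ‖holDefect E w‖ * dm ≤ 12 * S * t := by
      intro w hw
      have hb : ∀ f, IsCorner w f → ‖E (w, f)‖ * dm ≤ 3 * S * t := fun f hf =>
        corner_bound_of_minor hos ho hf (fun f f' hf hf' => hU w f f' hf hf' hw)
          (fun f f' hf hf' => hW w f f' hf hf' hw)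
      obtain ⟨c0, c1, -, c3⟩ := isCorner_site w
      calc ‖holDefect E w‖ * dm ≤ (2 * ‖E (w, w)‖ + ‖E (w, w - e0)‖ + ‖E (w, w - e1)‖) * dm :=
            mul_le_mul_of_nonneg_right (norm_holDefect_le E w) (norm_nonneg _)
        _ = 2 * (‖E (w, w)‖ * dm) + ‖E (w, w - e0)‖ * dm + ‖E (w, w - e1)‖ * dm := by ring
        _ ≤ 2 * (3 * S * t) + 3 * S * t + 3 * S * t :=
            add_le_add (add_le_add (mul_le_mul_of_nonneg_left (hb _ c0) (by norm_num)) (hb _ c1)) (hb _ c3)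
        _ = 12 * S * t := by ring
    have hle : ‖holDefect E v + holDefect E (v + e0)‖ * dm ≤ (ε * δ ^ ((1:ℝ) / 3)) * dm := by
      calc ‖holDefect E v + holDefect E (v + e0)‖ * dm ≤ (‖holDefect E v‖ + ‖holDefect E (v + e0)‖) * dm :=
            mul_le_mul_of_nonneg_right (norm_add_le _ _) (norm_nonneg _)
        _ ≤ 12 * S * t + 12 * S * t := by rw [add_mul]; exact add_le_add (key v hv0) (key _ hv1)
        _ = (ε * δ ^ ((1:ℝ) / 3)) * dm := by rw [htd]; field_simp; ring
    exact le_of_mul_le_mul_right hle hdpos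
  · push Not at hmin
    obtain ⟨χ, hχ, hu0, q1, q2, q3⟩ := character_of_minors hos hus hmin
    have hu0pos : 0 < ‖u 0‖ := norm_pos_iff.2 hu0
    -- pointwise smallness of one defect from a pointwise bound `‖u 0‖ ‖def‖ ≤ 2t`
    have pointwise : ∀ (df : (Site 2 × Site 2 → ℂ) → Site 2 → ℂ),
        (∀ (E : Site 2 × Site 2 → ℂ) (v : Site 2) (t : ℝ),
          (∀ f f', IsCorner v f → IsCorner v f' → ‖u (f' - v) * E (v, f) - u (f - v) * E (v, f')‖ ≤ t) →
            ‖u 0‖ * ‖df E v‖ ≤ 2 * t) →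
        ∀ (D : DobrushinDomain) (Λ : ℝ → DiscreteDobrushin), Guards D Λ →
          ∀ K : Set ℂ, IsCompact K → K ⊆ D.carrier → ∀ ε > (0:ℝ), ∀ᶠ δ in 𝓝[>] (0:ℝ), ∀ v : Site 2,
            meshPoint δ v ∈ K → ‖df (FinitaryGreenPairing.cornerObs Λ δ) v +
              df (FinitaryGreenPairing.cornerObs Λ δ) (v + e0)‖ ≤ ε * δ ^ ((1:ℝ) / 3) := by
      intro df hdf D Λ hG K hK hKD ε hε
      obtain ⟨K', hK', hK'D, hnear⟩ := eventually_pair_near hK hKD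
      have ht : 0 < ε * ‖u 0‖ / 4 := by positivity
      filter_upwards [cohU D Λ hG K' hK' hK'D _ ht, hnear] with δ hU hn v hv
      obtain ⟨hv0, hv1, -⟩ := hn v hv
      set E := FinitaryGreenPairing.cornerObs Λ δ with hE
      have b := fun w (hw : meshPoint δ w ∈ K') => hdf E w _ fun f f' hf hf' => hU w f f' hf hf' hw
      have hle : ‖u 0‖ * ‖df E v + df E (v + e0)‖ ≤ ‖u 0‖ * (ε * δ ^ ((1:ℝ) / 3)) := by
        calc ‖u 0‖ * ‖df E v + df E (v + e0)‖ ≤ ‖u 0‖ * (‖df E v‖ + ‖df E (v + e0)‖) :=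
              mul_le_mul_of_nonneg_left (norm_add_le _ _) (norm_nonneg _)
          _ = ‖u 0‖ * ‖df E v‖ + ‖u 0‖ * ‖df E (v + e0)‖ := mul_add _ _ _
          _ ≤ 2 * (ε * ‖u 0‖ / 4 * δ ^ ((1:ℝ) / 3)) + 2 * (ε * ‖u 0‖ / 4 * δ ^ ((1:ℝ) / 3)) :=
              add_le_add (b v hv0) (b _ hv1)
          _ = ‖u 0‖ * (ε * δ ^ ((1:ℝ) / 3)) := by ring
      exact le_of_mul_le_mul_left hle hu0pos
    rcases hχ with rfl | rfl | rfl | rfl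
    · -- `χ = 1`: holomorphic, pointwise
      exact Or.inl (pointwise holDefect fun E v t hU => holDefect_bound (Or.inl rfl) q1 q3 hU)
    · -- `χ = −1`: antiholomorphic, pointwise
      exact Or.inr (pointwise antiDefect fun E v t hU => antiDefect_bound (Or.inl rfl) q1 q3 hU)
    · -- `χ = i`: the staggered character; holomorphic defects cancel in pairs by Kirchhoff's relation
      left
      intro D Λ hG K hK hKD ε hε
      obtain ⟨K', hK', hK'D, hnear⟩ := eventually_pair_near hK hKD
      have ht : 0 < ε * ‖u 0‖ / 10 := by positivity
      have q2' : u (-e0 - e1) = -u 0 := by rw [q2, I_sq]; ring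
      have q3' : u (-e1) = -I * u 0 := by rw [q3, pow_succ, I_sq]; ring
      filter_upwards [cohU D Λ hG K' hK' hK'D _ ht, stub_kirchhoff D Λ hG K' hK' hK'D, hnear]
        with δ hU hKir hn v hv
      obtain ⟨hv0, hv1, hvm⟩ := hn v hv
      set E := FinitaryGreenPairing.cornerObs Λ δ with hE
      have b := holDefect_pair_bound (E := E) q1 q2' q3' (fun f f' hf hf' => hU v f f' hf hf' hv0)
        (fun f f' hf hf' => hU (v + e0) f f' hf hf' hv1) (hKir v 0 hvm)
      have hle : ‖u 0‖ * ‖holDefect E v + holDefect E (v + e0)‖ ≤ ‖u 0‖ * (ε * δ ^ ((1:ℝ) / 3)) := by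
        calc ‖u 0‖ * ‖holDefect E v + holDefect E (v + e0)‖ ≤ 10 * (ε * ‖u 0‖ / 10 * δ ^ ((1:ℝ) / 3)) := b
          _ = ‖u 0‖ * (ε * δ ^ ((1:ℝ) / 3)) := by ring
      exact le_of_mul_le_mul_left hle hu0pos
    · -- `χ = −i`: both defects vanish pointwise; record the holomorphic one
      exact Or.inl (pointwise holDefect fun E v t hU => holDefect_bound (Or.inr rfl) q1 q3 hU)

end Summit.CriticalPhenomena.CardyFormulaZ2.Cruxes.ParafermionToSLESixFamilies.PotentialDarbouxPicardDiamond

end
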